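/-
Copyright (c) 2026 the pub-hodgecm-mathlib formalisation cell (harness21).  Prover seat hodgecm-mathlib-K2E4-p09 (g3), Track B «K2-LIT» ∕ h413, road (d-w) of ‹J3› v2, letter (C-ratio),
brick (C1-I) «IWAHORI LEVEL COUNT» (road owner K2E3-p03 (g3) ORDERS 2026-09-04T03:29:34Z, GO 03:34:55Z), FILE 3b: the CM dress — `[I : K⁰(4)] = (q−1)·q^{8m−2+s}` at a wild place.  2026-09-04.
-/
import Literature.NumberTheory.Automorphic.UnitaryTwoAntidiagIwahoriLevelIndices         -- ★ (C1-I) FILES 1–2 (this seat): `relIndex_principalLevel_iwahori_eq_mul`, `exists_subgroup_principalLevel`, …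
import Literature.NumberTheory.Weil1982.UnitaryFinWildPlaceSkewUnitCounts                 -- ★ (C1-I) FILE 3a (this seat): the three abelian counts `q^{2m}`, `q^{2m−1+s}`, `(q−1)q^{4m−1}`
import Literature.NumberTheory.Weil1982.UnitaryFinTopFormMassAtRadius                      -- ★ R3a-1 (K2E3-p15): the `levelOf … (ballMat …)` currency of the (C1) cand
import Literature.NumberTheory.Automorphic.UnitaryTwoVertexStabilizerBruhatRamified       -- ★ FILE C (F0P3a-p04): `mem_cmLocalIntegralLevel_iff_forall_v_coe_localNonsplitEquiv_le_one`
import Literature.NumberTheory.Automorphic.UnitaryTwoRamifiedTreeAction                   -- ★ `unitaryGroupOfForm_placeForm_antidiagTwo_eq` (`U((Φ₂)_w) = U(!![0,1;1,0])`)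
import Summits.HodgeConjecture.HodgeConjecture.Theorems.K2E5BetaDetImageLevel             -- ★ `K2E5BetaDetImageLevel.resChar_eq_two_of_mem` (`p = 2` at a dyadic place)
import HarnessLib

/-!
# (C1-I) THE IWAHORI LEVEL COUNT AT A WILD PLACE: `[I : K⁰(4)] = (q − 1)·q^{8m−2+s}` — `(q−1)q^{8m−1}` (√π) ∕ `(q−1)q^{8m−2}` (√u)
(Tits 1979 §3.3.1, §3.7, §3.9; Cartier 1979 §III.5; Serre, *Local Fields* IV §2; Kottwitz 1988 §2 Thm. 2)

Cell `pub/hodgecm-mathlib` (D-0151), crux H413 = `stmt-HodgeConjecture-24833`, Track B «K2-LIT» (route `route-HodgeConjecture-HCCMUnconditional`); engine E3 unit U3b, letter ‹J3› v2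
`sig_K2E3CompatibleMeasureEPIdentityRankOne` ⟸ leaf (J3d-w) ⟸ (W3) `sig_K2E3WildPlaneMassIdentity` ⟸ (C-ratio) `sig_K2E3WildPlaneCountRatio` ⟸ (C1) `sig_K2E3WildIsotropicResidualCount` +
(C2) (★ assemblies p857062, p857088, K2E3-p15 (g3); road (d-w) owner K2E3-p03 (g3), `K2/K2E3-p03/g3/TARGETS-Cratio.K2E3-p03-g3.md`).  Brick **(C1-I) «IWAHORI LEVEL COUNT»**: with ★ F6∕F7
`[K⁰ : I] = q+1 ∕ 2` this gives (C1) `N_iso = [K⁰ : K⁰(4)] = (q−1)(q+1)q^{8m−2}` (√u) ∕ `2(q−1)q^{8m−1}` (√π) (closer: K2E3-p15 (g3)).  Kernel lane `--supports stmt-HodgeConjecture-24833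
--as helper`; theorems only, no `sorry`, no new axiom.

WHAT IS PROVED.  `L` CM, `w ∣ v` fixed by complex conjugation and RAMIFIED, `2 ∈ v` (so `p = resChar = 2`, `|2|_v = exp(−m)`, `m ≥ 1`), an anti-fixed `α ∈ L_w` with `|α|_w = exp(−s)`,
`s ≤ 1` (★ anti-fixed dichotomy: `s = 1` √π, `s = 0` √u); `Φ₂ = antidiag(1,1)`, `E₂ = localNonsplitEquiv` the one-place model `U(Φ₂)(L⁺_v) ≃ U(σ_w, (Φ₂)_w)(L_w) ≤ GL₂(L_w)`;
`K⁰(4) := levelOf L 2 Φ₂ v 1 (ballMat L 2 v resChar) _` (★ R3a-1's principal level at radius `a = p = 2`, depth `4`: THE (C1)∕(C-ratio) cand token), and `I` a BINDER subgroup with the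
Iwahori letter `g ∈ I ↔ g ∈ K⁰ ∧ |(E₂ g)₁₀|_w < 1` (★ F6 `sharp_iff_v_apply_one_zero_lt_one_of_mem` converts `K⁰ ⊓ K♯`).  THEN **`K⁰(4).relIndex I = (q − 1)·q^{8m−2+s}`**
(§2 `relIndex_levelOf_iwahori_eq_of_antifixed`), `q = #(𝓞_{L⁺}∕v)`, and the (C1)-cand-shaped corollary keyed on `α : L_wˣ` (§2 `relIndex_levelOf_iwahori_eq`: `|α| = exp(−1) → … =
(q−1)·q^(8m−1)`, `|α| = 1 → … = (q−1)·q^(8m−2)`).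
HOW.  §1 transports the two CM tokens along the injective homomorphism `Ψ = (↑) ∘ E₂ : U(Φ₂)(L⁺_v) →* GL₂(L_w)` (`relIndex_map_map_of_injective`): `Ψ(K⁰(4))` and `Ψ(I)` satisfy EXACTLY
the membership letters of ★ (C1-I) FILES 1–2 (`K(4) = {g ∈ U(𝒪) : g ≡ 1 (4)}`, `I = {g ∈ U(𝒪) : |g₁₀| < 1}` in `U(σ_w, !![0,1;1,0])`; `levelOf`'s `mat g − 1 ∈ 2·(p·M)` letter is read
entrywise at the unique place `w` as `|gᵢⱼ − δᵢⱼ| ≤ |4|`, `sub_one_mem_twoBall_ballMat_iff`, with `p = 2` ★ `resChar_eq_two_of_mem`; the inverse half of the `levelOf` letter comes from ★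
FILE 1's closure of the generic `K(4)`), so ★ FILE 2 `relIndex_principalLevel_iwahori_eq_mul` gives `[I : K⁰(4)] = [𝔪⁻:(4𝒪)⁻]·[𝒪^×:1+4𝒪]·[𝒪⁻:(4𝒪)⁻]`, and ★ FILE 3a evaluates the
three factors: `q^{2m−1+s} · (q−1)q^{4m−1} · q^{2m} = (q−1)·q^{8m−2+s}` — numerically `2⁷` (√u, ℚ₂(i)) ∕ `2⁸`∕… consistent with p03's `N_iso = 192 = 3·2⁶`, `256 = 2·2⁷` at `q = 2`, `m = 1`.
HONEST LABEL: HC_CM is proved only modulo the 7 printed citations (2 remaining named inputs: hLiu418 = `stmt-HodgeConjecture-24832`, h413 = `stmt-HodgeConjecture-24833`) until rung 0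
closes; count-neutral helper; (C1)∕(C-ratio)∕(W3)∕‹J3› are NOT proved here (this is one factor of (C1)).

## References
* [Tits1979] J. Tits, *Reductive groups over local fields*, PSPM 33.1 (1979), §3.3.1, §3.7 (Iwahori subgroups), §3.9 (ramified `U(1,1)`).
* [CartierCorvallis1979] P. Cartier, *Representations of 𝔭-adic groups: a survey*, PSPM 33.1 (1979), §III.5 (Iwahori factorisation).
* [Serre1979] J.-P. Serre, *Local Fields*, GTM 67 (1979), Ch. IV §1–2 (ramification, unit filtration; `e = 2`).
* [Kottwitz1988] R. E. Kottwitz, Tamagawa numbers, Ann. of Math. 127 (1988), §2 Thm. 2 (the EP∕residual-count identity this count serves).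
* [Jacobowitz1962] R. Jacobowitz, Hermitian forms over local fields, Amer. J. Math. 84 (1962), §§9–11 (the two ramified dyadic types).
-/

set_option autoImplicit false
set_option linter.dupNamespace false  -- the mandated namespace repeats the summit's segment, as in every `Theorems/*.lean` here

noncomputable section

open NumberField IsDedekindDomain Matrix
open Literature.NumberTheory.Automorphic Literature.NumberTheory.Automorphic.UnitaryGroup Literature.NumberTheory.Weil1982.UnitaryFinTopForm
open scoped MatrixGroups Matrix Valued WithZero

namespace Summit.HodgeConjecture.HodgeConjecture.Cruxes.H413.K2E3WildIwahoriLevelCount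

variable (L : Type) [Field L] [NumberField L] [IsCMField L] (v : HeightOneSpectrum (𝓞 ↥(maximalRealSubfield L)))
  (w : PlacesOver L v) (hw : IsCMField.complexConj L • w.1 = w.1) (he : v.asIdeal.ramificationIdx' w.1.asIdeal ≠ 1)

/-! ## §1 Reading the CM tokens entrywise at `w` -/

include hw in
/-- **THE `levelOf` LETTER AT DEPTH `4`, ENTRYWISE**: for `g ∈ U(Φ₂)(L⁺_v)` at a dyadic place (`p = 2`), `mat g − 1 ∈ 2·(p·M₂(𝒪_{E_v}))` iff every entry of `E₂ g − 1` has `|·|_w ≤ |4|_w`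
(the only place over `v` is `w`). [cite: Tits1979, §3.7] -/
theorem sub_one_mem_twoBall_ballMat_iff (h2 : (2 : 𝓞 ↥(maximalRealSubfield L)) ∈ v.asIdeal)
    (g : (cmDatum L 2 (Matrix.of fun i j : Fin 2 => if i.val + j.val + 1 = 2 then (1 : L) else 0)).Local v) :
    mat L 2 (Matrix.of fun i j : Fin 2 => if i.val + j.val + 1 = 2 then (1 : L) else 0) v g - 1 ∈
        twoBall L 2 v (ballMat L 2 v ((resChar L v : ℕ) : LocalRing L v)) ↔
      ∀ i j, Valued.v ((((((localNonsplitEquiv (IsCMField.complexConj L) (Matrix.of fun i j : Fin 2 => if i.val + j.val + 1 = 2 then (1 : L) else 0) (IsCMField.complexConj_ne_one L) w hw) g :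
          ↥(unitaryGroupOfForm (galAdicCompletionMap (L := L) (IsCMField.complexConj L) hw) (placeForm (Matrix.of fun i j : Fin 2 => if i.val + j.val + 1 = 2 then (1 : L) else 0) w.1))) :
          GL (Fin 2) (w.1.adicCompletion L)) : Matrix (Fin 2) (Fin 2) (w.1.adicCompletion L)) i j) - (1 : Matrix (Fin 2) (Fin 2) (w.1.adicCompletion L)) i j) ≤ Valued.v (4 : w.1.adicCompletion L) := by
  classical
  haveI := PlacesOver.subsingleton_of_smul_eq (IsCMField.complexConj L) (IsCMField.complexConj_ne_one L) w hw
  have hp : resChar L v = 2 := K2E5BetaDetImageLevel.resChar_eq_two_of_mem L v h2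
  -- the entries of `E₂ g` are those of `mat g` at `w`
  have hent : ∀ i j, (((((localNonsplitEquiv (IsCMField.complexConj L) (Matrix.of fun i j : Fin 2 => if i.val + j.val + 1 = 2 then (1 : L) else 0) (IsCMField.complexConj_ne_one L) w hw) g :
      ↥(unitaryGroupOfForm (galAdicCompletionMap (L := L) (IsCMField.complexConj L) hw) (placeForm (Matrix.of fun i j : Fin 2 => if i.val + j.val + 1 = 2 then (1 : L) else 0) w.1))) :
      GL (Fin 2) (w.1.adicCompletion L)) : Matrix (Fin 2) (Fin 2) (w.1.adicCompletion L)) i j) =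
      mat L 2 (Matrix.of fun i j : Fin 2 => if i.val + j.val + 1 = 2 then (1 : L) else 0) v g i j w := fun i j => by
    rw [coe_localNonsplitEquiv_apply, Matrix.map_apply, mat_def]; rfl
  have hone : ∀ i j : Fin 2, (1 : Matrix (Fin 2) (Fin 2) (LocalRing L v)) i j w = (1 : Matrix (Fin 2) (Fin 2) (w.1.adicCompletion L)) i j := fun i j => by
    rw [Matrix.one_apply, Matrix.one_apply]; split_ifs <;> rfl
  have h40 : (4 : w.1.adicCompletion L) ≠ 0 := by
    haveI : CharZero (w.1.adicCompletion L) := charZero_of_injective_algebraMap (algebraMap L _).injective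
    norm_num
  have hpw : ∀ w' : PlacesOver L v, ((resChar L v : ℕ) : LocalRing L v) w' = 2 := fun w' => by rw [Pi.natCast_apply, hp, Nat.cast_ofNat]
  constructor
  · intro h i j
    obtain ⟨X, hX, hX2⟩ := (mem_twoBall_iff L 2 v _ _).1 h
    obtain ⟨Y, hY, rfl⟩ := (mem_ballMat_iff L 2 v _ _).1 hX
    have hYij : Valued.v (Y i j w) ≤ 1 := (mem_localIntegers_rankOne_iff L v w hw _).1 ((mem_intMatrices_iff L 2 v Y).1 hY i j)
    have hentry := congrFun (congrFun (congrFun hX2 i) j) w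
    simp only [Matrix.smul_apply, smul_eq_mul, Pi.mul_apply, Matrix.sub_apply, Pi.sub_apply, hpw, Pi.ofNat_apply] at hentry
    rw [hent, ← hone, ← hentry, show (2 : w.1.adicCompletion L) * (2 * Y i j w) = 4 * Y i j w by ring, map_mul]
    exact mul_le_of_le_one_right' hYij
  · intro h
    let Y : Matrix (Fin 2) (Fin 2) (LocalRing L v) := fun i j w' =>
      (mat L 2 (Matrix.of fun i j : Fin 2 => if i.val + j.val + 1 = 2 then (1 : L) else 0) v g - 1) i j w' / 4
    have hYw : ∀ i j (w' : PlacesOver L v), Y i j w' = (mat L 2 (Matrix.of fun i j : Fin 2 => if i.val + j.val + 1 = 2 then (1 : L) else 0) v g - 1) i j w' / 4 := fun _ _ _ => rfl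
    refine (mem_twoBall_iff L 2 v _ _).2 ⟨((resChar L v : ℕ) : LocalRing L v) • Y, (mem_ballMat_iff L 2 v _ _).2 ⟨Y, (mem_intMatrices_iff L 2 v Y).2 fun i j => ?_, rfl⟩, ?_⟩
    · refine (mem_localIntegers_rankOne_iff L v w hw _).2 ?_
      rw [hYw, map_div₀, Matrix.sub_apply, Pi.sub_apply, hone, ← hent, div_le_iff₀ ((Valuation.pos_iff _).2 h40), one_mul]
      exact h i j
    · ext i j w'
      rw [Subsingleton.elim w' w]
      rw [Matrix.smul_apply, smul_eq_mul, Pi.mul_apply, Matrix.smul_apply, smul_eq_mul, Pi.mul_apply, hpw, Pi.ofNat_apply, hYw, ← mul_assoc,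
        show (2 : w.1.adicCompletion L) * 2 = 4 by norm_num, mul_div_cancel₀ _ h40]

/-! ## §2 The count -/

omit [IsCMField L] in
/-- At a dyadic place `|2|_v = exp(−m)` has `m ≥ 1`. [cite: Serre1979, Ch. IV §1] -/
theorem one_le_of_valued_two_eq (h2 : (2 : 𝓞 ↥(maximalRealSubfield L)) ∈ v.asIdeal) {m : ℕ}
    (hm : Valued.v (2 : v.adicCompletion ↥(maximalRealSubfield L)) = WithZero.exp (-(m : ℤ))) : 1 ≤ m := by
  have hcast : (2 : v.adicCompletion ↥(maximalRealSubfield L)) =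
      algebraMap ↥(maximalRealSubfield L) (v.adicCompletion ↥(maximalRealSubfield L)) (algebraMap (𝓞 ↥(maximalRealSubfield L)) ↥(maximalRealSubfield L) 2) := by
    rw [map_ofNat, map_ofNat]
  have hval : Valued.v (algebraMap ↥(maximalRealSubfield L) (v.adicCompletion ↥(maximalRealSubfield L)) (algebraMap (𝓞 ↥(maximalRealSubfield L)) ↥(maximalRealSubfield L) 2)) =
      v.valuation ↥(maximalRealSubfield L) (algebraMap (𝓞 ↥(maximalRealSubfield L)) ↥(maximalRealSubfield L) 2) := HeightOneSpectrum.valuedAdicCompletion_eq_valuation' v _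
  have hlt : Valued.v (2 : v.adicCompletion ↥(maximalRealSubfield L)) < 1 := by
    rw [hcast, hval, HeightOneSpectrum.valuation_of_algebraMap]; exact (HeightOneSpectrum.intValuation_lt_one_iff_mem v _).2 h2
  rw [hm, ← WithZero.exp_zero, WithZero.exp_lt_exp] at hlt
  omega

include he in
/-- **(C1-I) THE IWAHORI LEVEL COUNT AT A WILD PLACE: `[I : K⁰(4)] = (q − 1)·q^{8m−2+s}`** — `K⁰(4) = levelOf L 2 Φ₂ v 1 (ballMat L 2 v p) _` (the (C1) cand token, `p = resChar = 2`),
`I` the Iwahori binder `{g ∈ K⁰ : |(E₂g)₁₀|_w < 1}`, `|2|_v = exp(−m)`, anti-fixed generator of valuation `exp(−s)` (`s = 1` √π: `(q−1)q^{8m−1}`; `s = 0` √u: `(q−1)q^{8m−2}`).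
Transport along `E₂` into `U(σ_w, !![0,1;1,0]) ≤ GL₂(L_w)`, ★ FILE 2 `relIndex_principalLevel_iwahori_eq_mul`, ★ FILE 3a counts. [cite: Tits1979, §3.3.1, §3.7, §3.9]
[cite: CartierCorvallis1979, §III.5] [cite: Serre1979, Ch. IV §2 Prop. 6] [cite: Kottwitz1988, §2 Theorem 2] -/
theorem relIndex_levelOf_iwahori_eq_of_antifixed (h2 : (2 : 𝓞 ↥(maximalRealSubfield L)) ∈ v.asIdeal)
    {m s : ℕ} (hm : Valued.v (2 : v.adicCompletion ↥(maximalRealSubfield L)) = WithZero.exp (-(m : ℤ))) (hs : s ≤ 1)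
    (hα : ∃ α : w.1.adicCompletion L, galAdicCompletionMap (L := L) (IsCMField.complexConj L) hw α = -α ∧ Valued.v α = WithZero.exp (-(s : ℤ)))
    (ha : ∀ w' : PlacesOver L v, Valued.v (((resChar L v : ℕ) : LocalRing L v) w') < 1)
    (I : Subgroup ((cmDatum L 2 (Matrix.of fun i j : Fin 2 => if i.val + j.val + 1 = 2 then (1 : L) else 0)).Local v))
    (hI : ∀ g, g ∈ I ↔ g ∈ cmLocalIntegralLevel L 2 (Matrix.of fun i j : Fin 2 => if i.val + j.val + 1 = 2 then (1 : L) else 0) v ∧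
      Valued.v (((((localNonsplitEquiv (IsCMField.complexConj L) (Matrix.of fun i j : Fin 2 => if i.val + j.val + 1 = 2 then (1 : L) else 0) (IsCMField.complexConj_ne_one L) w hw) g :
        ↥(unitaryGroupOfForm (galAdicCompletionMap (L := L) (IsCMField.complexConj L) hw) (placeForm (Matrix.of fun i j : Fin 2 => if i.val + j.val + 1 = 2 then (1 : L) else 0) w.1))) :
        GL (Fin 2) (w.1.adicCompletion L)) : Matrix (Fin 2) (Fin 2) (w.1.adicCompletion L)) 1 0) < 1) :
    (levelOf L 2 (Matrix.of fun i j : Fin 2 => if i.val + j.val + 1 = 2 then (1 : L) else 0) v 1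
          (ballMat L 2 v ((resChar L v : ℕ) : LocalRing L v)) (ballMat_mul_closed L 2 v (mem_localIntegers_of_forall_valued_lt_one L v ha))).relIndex I =
      (Nat.card (𝓞 ↥(maximalRealSubfield L) ⧸ v.asIdeal) - 1) * Nat.card (𝓞 ↥(maximalRealSubfield L) ⧸ v.asIdeal) ^ (8 * m - 2 + s) := by
  classical
  have hc1 : IsCMField.complexConj L ≠ 1 := IsCMField.complexConj_ne_one L
  haveI := PlacesOver.subsingleton_of_smul_eq (IsCMField.complexConj L) hc1 w hw
  have hσσ : ∀ x, galAdicCompletionMap (L := L) (IsCMField.complexConj L) hw (galAdicCompletionMap (L := L) (IsCMField.complexConj L) hw x) = x :=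
    galAdicCompletionMap_galAdicCompletionMap_of_smul_eq (IsCMField.complexConj L) w hc1 hw
  have hvσ : ∀ x, Valued.v (galAdicCompletionMap (L := L) (IsCMField.complexConj L) hw x) = Valued.v x := fun x => by rw [valued_galAdicCompletionMap]
  have h4 : Valued.v (4 : w.1.adicCompletion L) = WithZero.exp (-(4 * (m : ℤ))) := valued_four_eq_of_ramified L v w hw he hm
  have hm1 : 1 ≤ m := one_le_of_valued_two_eq L v h2 hm
  have h4lt : Valued.v (4 : w.1.adicCompletion L) < 1 := by rw [h4, ← WithZero.exp_zero, WithZero.exp_lt_exp]; omega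
  -- the transport `Ψ = (↑) ∘ E₂ : U(Φ₂)(L⁺_v) →* GL₂(L_w)`
  obtain ⟨Ψ, hΨ⟩ : ∃ Ψ : (cmDatum L 2 (Matrix.of fun i j : Fin 2 => if i.val + j.val + 1 = 2 then (1 : L) else 0)).Local v →* GL (Fin 2) (w.1.adicCompletion L),
      ∀ g, Ψ g = (((localNonsplitEquiv (IsCMField.complexConj L) (Matrix.of fun i j : Fin 2 => if i.val + j.val + 1 = 2 then (1 : L) else 0) hc1 w hw) g :
        ↥(unitaryGroupOfForm (galAdicCompletionMap (L := L) (IsCMField.complexConj L) hw) (placeForm (Matrix.of fun i j : Fin 2 => if i.val + j.val + 1 = 2 then (1 : L) else 0) w.1))) :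
        GL (Fin 2) (w.1.adicCompletion L)) :=
    ⟨{ toFun := fun g => (((localNonsplitEquiv (IsCMField.complexConj L) (Matrix.of fun i j : Fin 2 => if i.val + j.val + 1 = 2 then (1 : L) else 0) hc1 w hw) g :
          ↥(unitaryGroupOfForm (galAdicCompletionMap (L := L) (IsCMField.complexConj L) hw) (placeForm (Matrix.of fun i j : Fin 2 => if i.val + j.val + 1 = 2 then (1 : L) else 0) w.1))) :
          GL (Fin 2) (w.1.adicCompletion L))
       map_one' := congrArg Subtype.val (map_one (localNonsplitEquiv (IsCMField.complexConj L) (Matrix.of fun i j : Fin 2 => if i.val + j.val + 1 = 2 then (1 : L) else 0) hc1 w hw))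
       map_mul' := fun x y => congrArg Subtype.val
         (map_mul (localNonsplitEquiv (IsCMField.complexConj L) (Matrix.of fun i j : Fin 2 => if i.val + j.val + 1 = 2 then (1 : L) else 0) hc1 w hw) x y) }, fun _ => rfl⟩
  have hΨinj : Function.Injective Ψ := fun a b h => by
    rw [hΨ, hΨ] at h
    exact (localNonsplitEquiv (IsCMField.complexConj L) (Matrix.of fun i j : Fin 2 => if i.val + j.val + 1 = 2 then (1 : L) else 0) hc1 w hw).injective (Subtype.ext h)
  have hΨU : ∀ g, Ψ g ∈ unitaryGroupOfForm (galAdicCompletionMap (L := L) (IsCMField.complexConj L) hw) !![(0 : w.1.adicCompletion L), 1; 1, 0] := fun g => by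
    rw [hΨ, ← unitaryGroupOfForm_placeForm_antidiagTwo_eq L v w (galAdicCompletionMap (L := L) (IsCMField.complexConj L) hw)]
    exact ((localNonsplitEquiv (IsCMField.complexConj L) (Matrix.of fun i j : Fin 2 => if i.val + j.val + 1 = 2 then (1 : L) else 0) hc1 w hw) g).2
  have hΨsurj : ∀ u : GL (Fin 2) (w.1.adicCompletion L), u ∈ unitaryGroupOfForm (galAdicCompletionMap (L := L) (IsCMField.complexConj L) hw) !![(0 : w.1.adicCompletion L), 1; 1, 0] →
      ∃ g, Ψ g = u := fun u hu => by
    have hu' : u ∈ unitaryGroupOfForm (galAdicCompletionMap (L := L) (IsCMField.complexConj L) hw)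
        (placeForm (Matrix.of fun i j : Fin 2 => if i.val + j.val + 1 = 2 then (1 : L) else 0) w.1) := by
      rw [unitaryGroupOfForm_placeForm_antidiagTwo_eq L v w (galAdicCompletionMap (L := L) (IsCMField.complexConj L) hw)]; exact hu
    exact ⟨(localNonsplitEquiv (IsCMField.complexConj L) (Matrix.of fun i j : Fin 2 => if i.val + j.val + 1 = 2 then (1 : L) else 0) hc1 w hw).symm ⟨u, hu'⟩,
      by rw [hΨ, ContinuousMulEquiv.apply_symm_apply]⟩
  -- the integral letter through `E₂`
  have hK0 : ∀ g, g ∈ cmLocalIntegralLevel L 2 (Matrix.of fun i j : Fin 2 => if i.val + j.val + 1 = 2 then (1 : L) else 0) v ↔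
      ∀ i j, Valued.v ((Ψ g) i j : w.1.adicCompletion L) ≤ 1 := fun g => by
    rw [hΨ]; exact mem_cmLocalIntegralLevel_iff_forall_v_coe_localNonsplitEquiv_le_one L v w hw g
  -- the generic principal level of ★ FILE 1 (for the inverse half of the `levelOf` letter)
  obtain ⟨K4g, hK4g⟩ := exists_subgroup_principalLevel (galAdicCompletionMap (L := L) (IsCMField.complexConj L) hw) hvσ
  -- THE TWO TRANSPORTED LETTERS
  have hK4' : ∀ u, u ∈ (levelOf L 2 (Matrix.of fun i j : Fin 2 => if i.val + j.val + 1 = 2 then (1 : L) else 0) v 1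
      (ballMat L 2 v ((resChar L v : ℕ) : LocalRing L v)) (ballMat_mul_closed L 2 v (mem_localIntegers_of_forall_valued_lt_one L v ha))).map Ψ ↔
      (u ∈ unitaryGroupOfForm (galAdicCompletionMap (L := L) (IsCMField.complexConj L) hw) !![(0 : w.1.adicCompletion L), 1; 1, 0] ∧ ∀ i j, Valued.v (u i j : w.1.adicCompletion L) ≤ 1) ∧
      ∀ i j, Valued.v ((u i j : w.1.adicCompletion L) - (1 : Matrix (Fin 2) (Fin 2) (w.1.adicCompletion L)) i j) ≤ Valued.v (4 : w.1.adicCompletion L) := by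
    intro u
    constructor
    · rintro ⟨g, hg, rfl⟩
      obtain ⟨-, hg1, -⟩ := (mem_levelOf_iff L 2 _ v 1 _ _ g).1 hg
      have hcong := (sub_one_mem_twoBall_ballMat_iff L v w hw h2 g).1 hg1
      refine ⟨⟨hΨU g, fun i j => ?_⟩, fun i j => by rw [hΨ]; exact hcong i j⟩
      have h1ij : Valued.v ((1 : Matrix (Fin 2) (Fin 2) (w.1.adicCompletion L)) i j) ≤ 1 := by
        rw [Matrix.one_apply]; split_ifs <;> simp
      rw [hΨ, ← sub_add_cancel ((((localNonsplitEquiv (IsCMField.complexConj L) (Matrix.of fun i j : Fin 2 => if i.val + j.val + 1 = 2 then (1 : L) else 0) hc1 w hw) g :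
        ↥(unitaryGroupOfForm (galAdicCompletionMap (L := L) (IsCMField.complexConj L) hw) (placeForm (Matrix.of fun i j : Fin 2 => if i.val + j.val + 1 = 2 then (1 : L) else 0) w.1))) :
        GL (Fin 2) (w.1.adicCompletion L)) i j : w.1.adicCompletion L) ((1 : Matrix (Fin 2) (Fin 2) (w.1.adicCompletion L)) i j)]
      exact (Valuation.map_add _ _ _).trans (max_le ((hcong i j).trans h4lt.le) h1ij)
    · rintro ⟨⟨huU, hui⟩, hu4⟩
      obtain ⟨g, rfl⟩ := hΨsurj u huU
      refine ⟨g, (mem_levelOf_iff L 2 _ v 1 _ _ g).2 ⟨?_, ?_, ?_⟩, rfl⟩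
      · exact Subgroup.mem_centralizer_iff.2 fun h hh => by rw [Set.mem_singleton_iff.1 hh, one_mul, mul_one]
      · refine (sub_one_mem_twoBall_ballMat_iff L v w hw h2 g).2 fun i j => ?_
        rw [← hΨ]; exact hu4 i j
      · have hinv : (Ψ g)⁻¹ ∈ K4g := K4g.inv_mem ((hK4g _).2 ⟨⟨huU, hui⟩, hu4⟩)
        rw [← map_inv] at hinv
        refine (sub_one_mem_twoBall_ballMat_iff L v w hw h2 g⁻¹).2 fun i j => ?_
        rw [← hΨ]; exact ((hK4g _).1 hinv).2 i j
  have hI' : ∀ u, u ∈ I.map Ψ ↔ (u ∈ unitaryGroupOfForm (galAdicCompletionMap (L := L) (IsCMField.complexConj L) hw) !![(0 : w.1.adicCompletion L), 1; 1, 0] ∧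
      ∀ i j, Valued.v (u i j : w.1.adicCompletion L) ≤ 1) ∧ Valued.v (u 1 0 : w.1.adicCompletion L) < 1 := by
    intro u
    constructor
    · rintro ⟨g, hg, rfl⟩
      obtain ⟨hg0, hg10⟩ := (hI g).1 hg
      exact ⟨⟨hΨU g, (hK0 g).1 hg0⟩, by rw [hΨ]; exact hg10⟩
    · rintro ⟨⟨huU, hui⟩, hu10⟩
      obtain ⟨g, rfl⟩ := hΨsurj u huU
      exact ⟨g, (hI g).2 ⟨(hK0 g).2 hui, by rw [← hΨ]; exact hu10⟩, rfl⟩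
  -- the abelian binders
  obtain ⟨S0, hS0⟩ := exists_addSubgroup_skew_le L v w hw (1 : ℤᵐ⁰)
  obtain ⟨S4, hS4⟩ := exists_addSubgroup_skew_le L v w hw (Valued.v (4 : w.1.adicCompletion L))
  obtain ⟨Sm, hSm⟩ : ∃ Sm : AddSubgroup (w.1.adicCompletion L), ∀ x, x ∈ Sm ↔ galAdicCompletionMap (L := L) (IsCMField.complexConj L) hw x = -x ∧ Valued.v x < 1 :=
    ⟨{ carrier := {x | galAdicCompletionMap (L := L) (IsCMField.complexConj L) hw x = -x ∧ Valued.v x < 1}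
       add_mem' := fun {a b} ha hb => ⟨by rw [map_add, ha.1, hb.1, neg_add], lt_of_le_of_lt (Valuation.map_add _ a b) (max_lt ha.2 hb.2)⟩
       zero_mem' := ⟨by rw [map_zero, neg_zero], by simp⟩
       neg_mem' := fun {a} ha => ⟨by rw [map_neg, ha.1], by rw [Valuation.map_neg]; exact ha.2⟩ }, fun _ => Iff.rfl⟩
  obtain ⟨U1, hU1⟩ : ∃ U1 : Subgroup (w.1.adicCompletion L)ˣ, ∀ u, u ∈ U1 ↔ Valued.v (u : w.1.adicCompletion L) = 1 :=
    ⟨{ carrier := {u | Valued.v (u : w.1.adicCompletion L) = 1}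
       mul_mem' := fun {a b} ha hb => by simp only [Set.mem_setOf_eq, Units.val_mul, map_mul] at ha hb ⊢; rw [ha, hb, mul_one]
       one_mem' := by simp
       inv_mem' := fun {a} ha => by simp only [Set.mem_setOf_eq, Units.val_inv_eq_inv_val, map_inv₀] at ha ⊢; rw [ha, inv_one] }, fun _ => Iff.rfl⟩
  obtain ⟨U4, hU4⟩ : ∃ U4 : Subgroup (w.1.adicCompletion L)ˣ, ∀ u, u ∈ U4 ↔ Valued.v (u : w.1.adicCompletion L) = 1 ∧
      Valued.v ((u : w.1.adicCompletion L) - 1) ≤ Valued.v (4 : w.1.adicCompletion L) :=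
    ⟨{ carrier := {u | Valued.v (u : w.1.adicCompletion L) = 1 ∧ Valued.v ((u : w.1.adicCompletion L) - 1) ≤ Valued.v (4 : w.1.adicCompletion L)}
       mul_mem' := fun {a b} ha hb => by
         refine ⟨by rw [Units.val_mul, map_mul, ha.1, hb.1, mul_one], ?_⟩
         rw [Units.val_mul, show (a : w.1.adicCompletion L) * b - 1 = ((a : w.1.adicCompletion L) - 1) * b + ((b : w.1.adicCompletion L) - 1) by ring]
         refine (Valuation.map_add _ _ _).trans (max_le ?_ hb.2)
         rw [map_mul, hb.1, mul_one]; exact ha.2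
       one_mem' := ⟨by simp, by simp⟩
       inv_mem' := fun {a} ha => by
         refine ⟨by rw [Units.val_inv_eq_inv_val, map_inv₀, ha.1, inv_one], ?_⟩
         rw [Units.val_inv_eq_inv_val, show ((a : w.1.adicCompletion L))⁻¹ - 1 = (1 - (a : w.1.adicCompletion L)) * ((a : w.1.adicCompletion L))⁻¹ by field_simp, map_mul, map_inv₀,
           ha.1, inv_one, mul_one, Valuation.map_sub_swap]
         exact ha.2 }, fun _ => Iff.rfl⟩
  -- transport, factorise, count
  rw [← Subgroup.relIndex_map_map_of_injective _ I hΨinj, relIndex_principalLevel_iwahori_eq_mul (galAdicCompletionMap (L := L) (IsCMField.complexConj L) hw) hσσ hvσ h4lt hK4' hI' hS0 hSm hS4 hU1 hU4,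
    relIndex_skewBall_four_lt_one_eq_pow L v w hw he hm hm1 hs hα hSm hS4, relIndex_unitLevel_four_eq L v w hw he hm hm1 hU1 hU4,
    relIndex_skewBall_four_one_eq_pow L v w hw he hm hs hα hS0 hS4]
  obtain ⟨m', rfl⟩ : ∃ m', m = m' + 1 := ⟨m - 1, by omega⟩
  rw [show 2 * (m' + 1) - 1 + s = 2 * m' + 1 + s by omega, show 4 * (m' + 1) - 1 = 4 * m' + 3 by omega, show 8 * (m' + 1) - 2 + s = 8 * m' + 6 + s by omega]
  ring

include he in
/-- **(C1-I) IN THE (C1) CAND'S SHAPE** (keyed on `α : L_wˣ` anti-fixed): `|α| = exp(−1)` (√π) ⇒ `[I : K⁰(4)] = (q−1)·q^{8m−1}`; `|α| = 1` (√u) ⇒ `[I : K⁰(4)] = (q−1)·q^{8m−2}` — the factor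
p15's (C1) closer multiplies by ★ F6∕F7 `[K⁰ : I] = q+1 ∕ 2`. [cite: Tits1979, §3.9] [cite: Kottwitz1988, §2 Theorem 2] [cite: Jacobowitz1962, §§9–11] -/
theorem relIndex_levelOf_iwahori_eq (h2 : (2 : 𝓞 ↥(maximalRealSubfield L)) ∈ v.asIdeal)
    {m : ℕ} (hm : Valued.v (2 : v.adicCompletion ↥(maximalRealSubfield L)) = WithZero.exp (-(m : ℤ)))
    (ha : ∀ w' : PlacesOver L v, Valued.v (((resChar L v : ℕ) : LocalRing L v) w') < 1)
    (α : (w.1.adicCompletion L)ˣ) (hσα : galAdicCompletionMap (L := L) (IsCMField.complexConj L) hw (α : w.1.adicCompletion L) = -(α : w.1.adicCompletion L))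
    (I : Subgroup ((cmDatum L 2 (Matrix.of fun i j : Fin 2 => if i.val + j.val + 1 = 2 then (1 : L) else 0)).Local v))
    (hI : ∀ g, g ∈ I ↔ g ∈ cmLocalIntegralLevel L 2 (Matrix.of fun i j : Fin 2 => if i.val + j.val + 1 = 2 then (1 : L) else 0) v ∧
      Valued.v (((((localNonsplitEquiv (IsCMField.complexConj L) (Matrix.of fun i j : Fin 2 => if i.val + j.val + 1 = 2 then (1 : L) else 0) (IsCMField.complexConj_ne_one L) w hw) g :
        ↥(unitaryGroupOfForm (galAdicCompletionMap (L := L) (IsCMField.complexConj L) hw) (placeForm (Matrix.of fun i j : Fin 2 => if i.val + j.val + 1 = 2 then (1 : L) else 0) w.1))) :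
        GL (Fin 2) (w.1.adicCompletion L)) : Matrix (Fin 2) (Fin 2) (w.1.adicCompletion L)) 1 0) < 1) :
    (Valued.v (α : w.1.adicCompletion L) = WithZero.exp (-1 : ℤ) →
      (levelOf L 2 (Matrix.of fun i j : Fin 2 => if i.val + j.val + 1 = 2 then (1 : L) else 0) v 1
          (ballMat L 2 v ((resChar L v : ℕ) : LocalRing L v)) (ballMat_mul_closed L 2 v (mem_localIntegers_of_forall_valued_lt_one L v ha))).relIndex I =
        (Nat.card (𝓞 ↥(maximalRealSubfield L) ⧸ v.asIdeal) - 1) * Nat.card (𝓞 ↥(maximalRealSubfield L) ⧸ v.asIdeal) ^ (8 * m - 1)) ∧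
    (Valued.v (α : w.1.adicCompletion L) = 1 →
      (levelOf L 2 (Matrix.of fun i j : Fin 2 => if i.val + j.val + 1 = 2 then (1 : L) else 0) v 1
          (ballMat L 2 v ((resChar L v : ℕ) : LocalRing L v)) (ballMat_mul_closed L 2 v (mem_localIntegers_of_forall_valued_lt_one L v ha))).relIndex I =
        (Nat.card (𝓞 ↥(maximalRealSubfield L) ⧸ v.asIdeal) - 1) * Nat.card (𝓞 ↥(maximalRealSubfield L) ⧸ v.asIdeal) ^ (8 * m - 2)) := by
  have hm1 : 1 ≤ m := one_le_of_valued_two_eq L v h2 hm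
  refine ⟨fun hπ => ?_, fun hu => ?_⟩
  · rw [relIndex_levelOf_iwahori_eq_of_antifixed L v w hw he h2 hm le_rfl ⟨α, hσα, hπ⟩ ha I hI, show 8 * m - 2 + 1 = 8 * m - 1 by omega]
  · rw [relIndex_levelOf_iwahori_eq_of_antifixed L v w hw he h2 hm (Nat.zero_le 1) ⟨α, hσα, by rw [hu, Nat.cast_zero, neg_zero, WithZero.exp_zero]⟩ ha I hI, add_zero]

end Summit.HodgeConjecture.HodgeConjecture.Cruxes.H413.K2E3WildIwahoriLevelCount

end
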